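import Summits.BirchSwinnertonDyer.BirchSwinnertonDyer.Theorems.ManinLocalTwoThreeShimuraQuotientAtkinLehnerParity
import Mathlib.FieldTheory.Finite.Basic
import HarnessLib

/-!
# The Atkin–Lehner SIGN PATTERN of a Shimura `3`-kernel (unconditional): at `9 ∣ N` a Kummer–Shimura third-period forbids two Atkin–Lehner minus divisors, a minus divisor `Q` with `3 ∤ φ(Q)`, and `w₉ = −1` at `9 ∥ N`
(route `ManinLocalTwoThree`, crux C3 `ManinPrimeToThreeAtNine` stmt-BirchSwinnertonDyer-22968; cell bsd-f2-manin, C3 LEAD p1 gen 17;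
`--supports stmt-BirchSwinnertonDyer-22968`; node E-an-221 — fifth habitat file, consequences of `…ShimuraQuotientAtkinLehnerParity`)

From the Atkin–Lehner parity (`w_Q f = −f` ⟹ every period with `d ≡ 1 (mod Q)` lies in `Λ₁(f)` at `9 ∣ N`) three UNCONDITIONAL collapses
`Λ₁(f) = Λ₀(f)` — hence `¬ KummerShimura D u` for every third-period `u`, hence E-an-221 outright — for a lattice-optimal datum at `9 ∣ N`:
* §1 **`periodLatticeGamma1_eq_of_atkinLehner_minus_of_coprime_totient`** — ONE minus divisor `Q ∥ N` with `3 ∤ φ(Q)` (e.g. `Q = q^e`, `q ≡ 2 (mod 3)` prime):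
  `θ` factors through `(ℤ/Q)ˣ`, a group of order prime to `3`, while `3Λ₀ ⊆ Λ₁` (Euler `d^{φ(Q)} ≡ 1`, Bézout);
* §2 **`periodLatticeGamma1_eq_of_two_atkinLehner_minus`** — TWO coprime minus divisors `Q₁, Q₂ ∥ N`: `θ` factors through `(ℤ/Q₁)ˣ` and through `(ℤ/Q₂)ˣ`,
  so through the trivial group (`γ = γ₁·(γ₁⁻¹γ)` with `d_{γ₁} ≡ d (Q₁)`, `≡ 1 (N/Q₁)`);
* §3 **`periodLatticeGamma1_eq_of_atkinLehner_nine_minus`** — `N = 9M'`, `3 ∤ M'`, `w₉ f = −f`: `θ` factors through `(ℤ/9)ˣ` (parity) AND through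
  `(ℤ/3M')ˣ` (the lead's cuspidal inertia, `u = 3`, `v = M'`), hence through `(ℤ/3)ˣ = {±1}`, on which `θ` vanishes (explicit lift `d' = d + M'²(1 − d)`).
* §4 the E-an-221 dressing: `not_kummerShimura_…` and **the sign pattern of a Shimura 3-kernel**: `w_N = −1` (Fricke parity, p741278), no two minus exact
  divisors, every minus divisor has `3 ∣ φ(Q)`, and `w₉ = +1` when `9 ∥ N`.  So (with `ε_N = ∏ ε_{q^e}`) there is EXACTLY ONE minus prime power `p₀^e ∥ N`,
  with `p₀ ≡ 1 (mod 3)` or (`p₀ = 3`, `e ≥ 3`): the habitat of E-an-221.  Data: 27a1 (`ε₃ = −1`, `27 ∣ N`) ✓; 54a1 (`a₂ = −1` so `ε₂ = +1`; `ε₂₇ = −1`) ✓.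

HONEST FRAMING.  Unconditional theorems about the tree's period lattices; they settle E-an-221 only where its hypothesis is contradictory.  E-an-221 on its
habitat, RES₃♭, C3, Manin's conjecture and BSD are NOT proved.  No definitions, no named facts, no sorry.
[cite: AtkinLehner1970, §2 and Thm. 3] [cite: Knapp1993, Lemma 9.24, Thm. 9.27] [cite: LingOesterle1991, §1, Thm. 1 (shape)] [cite: Manin1972, Prop. 1.4 / Thm. 1.6]
-/

set_option autoImplicit false
-- lint-debt: the directory name repeats the summit name (sibling precedent `ManinLocalTwoThreeShimuraQuotientAtkinLehnerParity.lean`)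
set_option linter.dupNamespace false

noncomputable section

open scoped Classical ComplexConjugate MatrixGroups ModularForm PeriodPair
open CongruenceSubgroup Complex
open WeierstrassCurve Literature.NumberTheory.EllipticCurves Literature.NumberTheory.EllipticCurves.ModularForms
open Summit.BirchSwinnertonDyer.Rank1Residual.ManinAdditive.CuspidalKummer
open Summit.BirchSwinnertonDyer.Rank1Residual.ManinAdditive.CuspidalKummerThree
open Summit.BirchSwinnertonDyer.Rank1Residual.ManinAdditive.UDCKummerLine
open Summit.BirchSwinnertonDyer.Rank1Residual.ManinAdditive.UDCKummerLineK
open Summit.BirchSwinnertonDyer.Rank1Residual.ManinAdditive.ShimuraThreeTorsion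

namespace Summit.BirchSwinnertonDyer.BirchSwinnertonDyer.Theorems.ManinLocalTwoThree.SigmaHabitat

variable {W : WeierstrassCurve ℚ} {N : ℕ} [NeZero N]

/-! ## §0 Small helpers -/

omit [NeZero N] in
/-- `(x : ℤ/Q) = 1 ⟹ Q ∣ x − 1`. [folklore] -/
theorem natCast_dvd_sub_one_of_cast_eq_one {Q : ℕ} {x : ℤ} (h : ((x : ℤ) : ZMod Q) = 1) : (Q : ℤ) ∣ x - 1 :=
  (ZMod.intCast_eq_intCast_iff_dvd_sub 1 x Q).mp (by rw [Int.cast_one]; exact h.symm)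

/-- The lower-right entry of `γ ∈ Γ₀(N)` is a unit modulo any `Q ∣ N`. [folklore] -/
theorem isUnit_apply_one_one_mod (γ : Gamma0 N) {Q : ℕ} (hQN : Q ∣ N) :
    IsUnit ((((γ : SL(2, ℤ)) 1 1 : ℤ)) : ZMod Q) := by
  have h := (isUnit_apply_one_one γ).map (ZMod.castHom hQN (ZMod Q))
  rwa [map_intCast] at h

/-- Euler: `d_γ^{φ(Q)} ≡ 1 (mod Q)` for `Q ∣ N`, so `Q ∣ d_{γ^{φ(Q)}} − 1`. [folklore] -/
theorem natCast_dvd_apply_one_one_pow_totient_sub_one (γ : Gamma0 N) {Q : ℕ} [NeZero Q] (hQN : Q ∣ N) :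
    (Q : ℤ) ∣ (((γ ^ Nat.totient Q : Gamma0 N) : SL(2, ℤ)) 1 1 : ℤ) - 1 := by
  refine natCast_dvd_sub_one_of_cast_eq_one ?_
  have hpow := congrArg (ZMod.castHom hQN (ZMod Q)) (apply_one_one_pow_eq γ (Nat.totient Q))
  rw [map_intCast, map_pow, map_intCast] at hpow
  rw [hpow]
  obtain ⟨u, hu⟩ := isUnit_apply_one_one_mod γ hQN
  rw [← hu, ← Units.val_pow_eq_pow_val, ZMod.pow_totient, Units.val_one]

/-- The units of `ℤ/3` are `±1`. [folklore] -/
theorem zmod_three_eq_one_or_eq_neg_one {x : ZMod 3} (hx : IsUnit x) : x = 1 ∨ x = -1 := by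
  haveI : Fact (Nat.Prime 3) := ⟨Nat.prime_three⟩
  have h2 : x ^ 2 = 1 := by
    obtain ⟨u, rfl⟩ := hx
    have h := ZMod.pow_totient u
    rw [Nat.totient_prime Nat.prime_three] at h
    rw [← Units.val_pow_eq_pow_val, h, Units.val_one]
  have h0 : (x - 1) * (x + 1) = 0 := by linear_combination h2
  rcases mul_eq_zero.mp h0 with h | h
  · left; linear_combination h
  · right; linear_combination h

/-! ## §1 One minus divisor `Q` with `3 ∤ φ(Q)` -/

/-- **`w_Q f = −f`, `3 ∤ φ(Q)`, `9 ∣ N` ⟹ `Λ₁(f) = Λ₀(f)`.**  For every `γ`: `φ(Q)·{∞,γ∞} = {∞, γ^{φ(Q)}∞} ∈ Λ₁` (parity, `d^{φ(Q)} ≡ 1 (Q)`) and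
`3·{∞,γ∞} ∈ Λ₁` (traceless `3`); Bézout. [cite: AtkinLehner1970, Thm. 3] -/
theorem periodLatticeGamma1_eq_of_atkinLehner_minus_of_coprime_totient (D : ModularParametrizationData W N) (h9 : 3 ^ 2 ∣ N)
    (Q : ℕ) [NeZero Q] (hQN : Q ∣ N) (hc : Nat.Coprime Q (N / Q)) (hQ : 1 < Q)
    (hε : atkinLehnerInvolution N 2 Q D.f = (-1 : ℂ) • D.f) (hcop : Nat.Coprime 3 (Nat.totient Q)) :
    periodLatticeGamma1 D.f = periodLattice D.f := by
  refine le_antisymm (periodLatticeGamma1_le_periodLattice D.f) fun z hz ↦ ?_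
  have hz' : z ∈ (periodLattice D.f : Set ℂ) := hz
  rw [coe_periodLattice_eq_range] at hz'
  obtain ⟨γ, rfl⟩ := hz'
  set k : ℕ := Nat.totient Q with hk
  have hkmem : (k : ℂ) * cuspSymbol D.f γ ∈ periodLatticeGamma1 D.f := by
    rw [← cuspSymbol_pow_eq_natCast_mul]
    exact cuspSymbol_mem_periodLatticeGamma1_of_atkinLehner_minus_of_nine_dvd D h9 Q hQN hc hQ hε (γ ^ k)
      (natCast_dvd_apply_one_one_pow_totient_sub_one γ hQN)
  have h3 := three_mul_mem_periodLatticeGamma1_of_nine_dvd D h9 (cuspSymbol_mem_periodLattice D.f γ)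
  obtain ⟨a, b, hab⟩ := Nat.isCoprime_iff_coprime.mpr hcop
  have hab' : a * 3 + b * (k : ℤ) = 1 := by simpa using hab
  have h1 : (a : ℂ) * 3 + (b : ℂ) * (k : ℂ) = 1 := by exact_mod_cast hab'
  have key : cuspSymbol D.f γ = (a : ℂ) * (3 * cuspSymbol D.f γ) + (b : ℂ) * ((k : ℂ) * cuspSymbol D.f γ) := by
    linear_combination -cuspSymbol D.f γ * h1
  rw [key]
  have ha := (periodLatticeGamma1 D.f).zsmul_mem h3 a
  have hb := (periodLatticeGamma1 D.f).zsmul_mem hkmem b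
  rw [zsmul_eq_mul] at ha hb
  exact add_mem ha hb

/-! ## §2 Two coprime minus divisors -/

omit [NeZero N] in
/-- The lower-right entry of `γ₁⁻¹γ` is `≡ a_{γ₁} d_γ (mod Q)` for `Q ∣ N`; if `d_{γ₁} ≡ d_γ (mod Q)` it is `≡ 1`. [folklore] -/
theorem natCast_dvd_inv_mul_apply_one_one_sub_one (γ₁ γ : Gamma0 N) {Q : ℕ} (hQN : Q ∣ N)
    (hd : (Q : ℤ) ∣ ((γ₁ : SL(2, ℤ)) 1 1 : ℤ) - ((γ : SL(2, ℤ)) 1 1 : ℤ)) :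
    (Q : ℤ) ∣ (((γ₁⁻¹ * γ : Gamma0 N) : SL(2, ℤ)) 1 1 : ℤ) - 1 := by
  have e11 : ((((γ₁⁻¹ * γ : Gamma0 N)) : SL(2, ℤ)) 1 1 : ℤ) =
      -((γ₁ : SL(2, ℤ)) 1 0) * (γ : SL(2, ℤ)) 0 1 + (γ₁ : SL(2, ℤ)) 0 0 * (γ : SL(2, ℤ)) 1 1 := by
    rw [Subgroup.coe_mul, Subgroup.coe_inv, Matrix.SpecialLinearGroup.SL2_inv_expl,
      Matrix.SpecialLinearGroup.coe_mul]
    simp [Matrix.mul_apply, Fin.sum_univ_two]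
  have hdet := Matrix.det_fin_two (γ₁ : SL(2, ℤ)).1
  rw [Matrix.SpecialLinearGroup.det_coe] at hdet
  have hQN' : (Q : ℤ) ∣ (N : ℤ) := by exact_mod_cast hQN
  obtain ⟨c', hc'⟩ : (Q : ℤ) ∣ ((γ₁ : SL(2, ℤ)) 1 0 : ℤ) :=
    hQN'.trans ((ZMod.intCast_zmod_eq_zero_iff_dvd _ N).mp (Gamma0_mem.mp γ₁.2))
  obtain ⟨k, hk⟩ := hd
  rw [e11]
  exact ⟨-c' * ((γ : SL(2, ℤ)) 0 1 : ℤ) - ((γ₁ : SL(2, ℤ)) 0 0 : ℤ) * k + ((γ₁ : SL(2, ℤ)) 0 1 : ℤ) * c', by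
    linear_combination (-((γ : SL(2, ℤ)) 0 1 : ℤ) + ((γ₁ : SL(2, ℤ)) 0 1 : ℤ)) * hc' - ((γ₁ : SL(2, ℤ)) 0 0 : ℤ) * hk - hdet⟩

/-- **Two coprime exact divisors `Q₁, Q₂ ∥ N` with `w_{Q₁} f = w_{Q₂} f = −f`, `9 ∣ N` ⟹ `Λ₁(f) = Λ₀(f)`.**  Write `γ = γ₁·(γ₁⁻¹γ)` with
`d_{γ₁} ≡ d_γ (mod Q₁)`, `d_{γ₁} ≡ 1 (mod N/Q₁)`: the first factor has `d ≡ 1 (mod Q₂)` (as `Q₂ ∣ N/Q₁`), the second `d ≡ 1 (mod Q₁)`; both periods lie in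
`Λ₁` by the minus-sign parity. [cite: AtkinLehner1970, Thm. 3] -/
theorem periodLatticeGamma1_eq_of_two_atkinLehner_minus (D : ModularParametrizationData W N) (h9 : 3 ^ 2 ∣ N)
    (Q₁ Q₂ : ℕ) [NeZero Q₁] [NeZero Q₂] (h₁ : Q₁ ∣ N) (hc₁ : Nat.Coprime Q₁ (N / Q₁)) (hQ₁ : 1 < Q₁)
    (h₂ : Q₂ ∣ N) (hc₂ : Nat.Coprime Q₂ (N / Q₂)) (hQ₂ : 1 < Q₂) (hcop : Nat.Coprime Q₁ Q₂)
    (hε₁ : atkinLehnerInvolution N 2 Q₁ D.f = (-1 : ℂ) • D.f) (hε₂ : atkinLehnerInvolution N 2 Q₂ D.f = (-1 : ℂ) • D.f) :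
    periodLatticeGamma1 D.f = periodLattice D.f := by
  refine le_antisymm (periodLatticeGamma1_le_periodLattice D.f) fun z hz ↦ ?_
  have hz' : z ∈ (periodLattice D.f : Set ℂ) := hz
  rw [coe_periodLattice_eq_range] at hz'
  obtain ⟨γ, rfl⟩ := hz'
  set M₁ : ℕ := N / Q₁ with hM₁
  have hNQM : (N : ℤ) = Q₁ * M₁ := by exact_mod_cast (Nat.mul_div_cancel' h₁).symm
  have hQ₂M : (Q₂ : ℤ) ∣ (M₁ : ℤ) := by
    have h : Q₂ ∣ Q₁ * M₁ := by rw [Nat.mul_div_cancel' h₁]; exact h₂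
    exact_mod_cast hcop.symm.dvd_of_dvd_mul_left h
  -- Bezout `α Q₁ + β M₁ = 1`, target residue `x = d β M₁ + α Q₁`
  obtain ⟨α, β, hαβ⟩ := Nat.isCoprime_iff_coprime.mpr hc₁
  set d : ℤ := (γ : SL(2, ℤ)) 1 1 with hdd
  set x : ℤ := d * (β * M₁) + α * Q₁ with hx
  have hxQ : (Q₁ : ℤ) ∣ x - d := ⟨α - d * α, by rw [hx]; linear_combination d * hαβ⟩
  have hxM : (M₁ : ℤ) ∣ x - 1 := ⟨d * β - β, by rw [hx]; linear_combination hαβ⟩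
  -- `x` is a unit mod `N`
  have hunitN : IsUnit ((x : ℤ) : ZMod N) := by
    rw [ZMod.coe_int_isUnit_iff_isCoprime]
    have hdN : IsCoprime (d : ℤ) (N : ℤ) := by
      rw [isCoprime_comm]; exact (ZMod.coe_int_isUnit_iff_isCoprime d N).mp (isUnit_apply_one_one γ)
    have hdQM : IsCoprime (d : ℤ) ((Q₁ : ℤ) * M₁) := hNQM ▸ hdN
    have hQ1x : IsCoprime (Q₁ : ℤ) x := by
      obtain ⟨k, hk⟩ := hxQ
      have e : x = d + Q₁ * k := by linear_combination hk
      rw [e]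
      exact hdQM.of_mul_right_left.symm.add_mul_left_right k
    have hM1x : IsCoprime (M₁ : ℤ) x := by
      obtain ⟨k, hk⟩ := hxM
      have e : x = 1 + M₁ * k := by linear_combination hk
      rw [e]
      exact isCoprime_one_right.add_mul_left_right k
    rw [hNQM]
    exact hQ1x.mul_left hM1x
  obtain ⟨γ₁, hγ₁⟩ := exists_gamma0_apply_one_one_eq_of_isUnit hunitN
  have hγ₁x : (N : ℤ) ∣ x - ((γ₁ : SL(2, ℤ)) 1 1 : ℤ) := (ZMod.intCast_eq_intCast_iff_dvd_sub _ _ N).mp hγ₁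
  have hNQ₁ : (Q₁ : ℤ) ∣ (N : ℤ) := by exact_mod_cast h₁
  have hNM₁ : (M₁ : ℤ) ∣ (N : ℤ) := ⟨Q₁, by rw [hNQM]; ring⟩
  -- first factor: `d_{γ₁} ≡ 1 (mod Q₂)`
  have hγ₁Q₂ : (Q₂ : ℤ) ∣ ((γ₁ : SL(2, ℤ)) 1 1 : ℤ) - 1 := by
    have h : (M₁ : ℤ) ∣ ((γ₁ : SL(2, ℤ)) 1 1 : ℤ) - 1 := by
      have e : ((γ₁ : SL(2, ℤ)) 1 1 : ℤ) - 1 = (x - 1) - (x - ((γ₁ : SL(2, ℤ)) 1 1 : ℤ)) := by ring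
      rw [e]; exact dvd_sub hxM (hNM₁.trans hγ₁x)
    exact hQ₂M.trans h
  have hmem₁ := cuspSymbol_mem_periodLatticeGamma1_of_atkinLehner_minus_of_nine_dvd D h9 Q₂ h₂ hc₂ hQ₂ hε₂ γ₁ hγ₁Q₂
  -- second factor: `d_{γ₁⁻¹γ} ≡ 1 (mod Q₁)`
  have hdQ₁ : (Q₁ : ℤ) ∣ ((γ₁ : SL(2, ℤ)) 1 1 : ℤ) - d := by
    have e : ((γ₁ : SL(2, ℤ)) 1 1 : ℤ) - d = (x - d) - (x - ((γ₁ : SL(2, ℤ)) 1 1 : ℤ)) := by ring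
    rw [e]; exact dvd_sub hxQ (hNQ₁.trans hγ₁x)
  have hmem₂ := cuspSymbol_mem_periodLatticeGamma1_of_atkinLehner_minus_of_nine_dvd D h9 Q₁ h₁ hc₁ hQ₁ hε₁ (γ₁⁻¹ * γ)
    (natCast_dvd_inv_mul_apply_one_one_sub_one γ₁ γ h₁ hdQ₁)
  have hmul : cuspSymbol D.f γ = cuspSymbol D.f γ₁ + cuspSymbol D.f (γ₁⁻¹ * γ) := by
    rw [← cuspSymbol_mul_holds D.f γ₁ (γ₁⁻¹ * γ), mul_inv_cancel_left]
  rw [hmul]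
  exact add_mem hmem₁ hmem₂

/-! ## §3 `w₉ = −1` at `9 ∥ N` -/

/-- **`N = 9M'`, `3 ∤ M'`, `w₉ f = −f` ⟹ `Λ₁(f) = Λ₀(f)`.**  WLOG `d ≡ 1 (mod 3)` (`−γ` has the same period); the explicit lift
`d' = d + M'²(1 − d)` is `≡ d (mod 3M')` and `≡ 1 (mod 9)`, so `{∞,γ∞} ≡ {∞,γ'∞} (mod Λ₁)` by cuspidal inertia (`u = 3`, `v = M'`) and `{∞,γ'∞} ∈ Λ₁`
by the minus-sign parity at `Q = 9`. [cite: AtkinLehner1970, Thm. 3] [cite: LingOesterle1991, Thm. 1 (shape)] -/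
theorem periodLatticeGamma1_eq_of_atkinLehner_nine_minus (D : ModularParametrizationData W N) {M' : ℕ} (hN : N = 9 * M')
    (hM' : Nat.Coprime 3 M') (hε : atkinLehnerInvolution N 2 9 D.f = (-1 : ℂ) • D.f) :
    periodLatticeGamma1 D.f = periodLattice D.f := by
  have h9 : 3 ^ 2 ∣ N := ⟨M', by rw [hN]; norm_num⟩
  have h9N : 9 ∣ N := ⟨M', hN⟩
  have hNQ : N / 9 = M' := by rw [hN]; exact Nat.mul_div_cancel_left M' (by norm_num)
  have hc9 : Nat.Coprime 9 (N / 9) := by rw [hNQ]; exact (Nat.Coprime.pow_left 2 hM' : Nat.Coprime (3 ^ 2) M')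
  have hNZ : (N : ℤ) = (3 : ℤ) ^ 2 * M' := by rw [hN]; push_cast; ring
  refine le_antisymm (periodLatticeGamma1_le_periodLattice D.f) fun z hz ↦ ?_
  have hz' : z ∈ (periodLattice D.f : Set ℂ) := hz
  rw [coe_periodLattice_eq_range] at hz'
  obtain ⟨γ, rfl⟩ := hz'
  -- WLOG `d ≡ 1 (mod 3)`
  suffices key : ∀ γ : Gamma0 N, (3 : ℤ) ∣ ((γ : SL(2, ℤ)) 1 1 : ℤ) - 1 → cuspSymbol D.f γ ∈ periodLatticeGamma1 D.f by
    have h3unit : IsUnit ((((γ : SL(2, ℤ)) 1 1 : ℤ)) : ZMod 3) :=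
      isUnit_apply_one_one_mod γ ((dvd_pow_self 3 two_ne_zero).trans h9)
    -- units of `ℤ/3` are `±1`
    rcases zmod_three_eq_one_or_eq_neg_one h3unit with h1 | h1
    · exact key γ (natCast_dvd_sub_one_of_cast_eq_one h1)
    · obtain ⟨γ', -, -, h11, hγ'⟩ := exists_neg_entries_cuspSymbol_eq D.f γ
      rw [← hγ']
      refine key γ' (natCast_dvd_sub_one_of_cast_eq_one ?_)
      rw [h11, Int.cast_neg, h1, neg_neg]
  intro γ hd3
  set d : ℤ := (γ : SL(2, ℤ)) 1 1 with hdd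
  obtain ⟨y, hy⟩ := hd3
  -- the lift `d' = d + M'²(1 − d)`
  set d' : ℤ := d + (M' : ℤ) ^ 2 * (1 - d) with hd'
  have hM'sq : (3 : ℤ) ∣ (M' : ℤ) ^ 2 - 1 := by
    have hu : IsUnit ((M' : ℕ) : ZMod 3) := (ZMod.isUnit_iff_coprime M' 3).mpr hM'.symm
    have hsq : (((M' : ℤ) ^ 2 : ℤ) : ZMod 3) = 1 := by
      push_cast
      rcases zmod_three_eq_one_or_eq_neg_one hu with h | h <;> rw [h] <;> norm_num
    exact natCast_dvd_sub_one_of_cast_eq_one hsq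
  have hd'1 : ((9 : ℕ) : ℤ) ∣ d' - 1 := by
    obtain ⟨t, ht⟩ := hM'sq
    refine ⟨-(y * t), ?_⟩
    have e : d' - 1 = -((d - 1) * ((M' : ℤ) ^ 2 - 1)) := by rw [hd']; ring
    rw [e, hy, ht]; push_cast; ring
  have hd'd : ((3 * M' : ℕ) : ℤ) ∣ d' - d := ⟨-(M' * y), by rw [hd']; push_cast; linear_combination (-((M' : ℤ) ^ 2)) * hy⟩
  -- `d'` is a unit mod `N`; realise it
  have hunitN : IsUnit ((d' : ℤ) : ZMod N) := by
    rw [ZMod.coe_int_isUnit_iff_isCoprime]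
    have hdN : IsCoprime (d : ℤ) (N : ℤ) := by
      rw [isCoprime_comm]; exact (ZMod.coe_int_isUnit_iff_isCoprime d N).mp (isUnit_apply_one_one γ)
    have hNZ' : (N : ℤ) = 9 * M' := by exact_mod_cast hN
    have hdQM : IsCoprime (d : ℤ) ((9 : ℤ) * M') := hNZ' ▸ hdN
    have h9x : IsCoprime (9 : ℤ) d' := by
      obtain ⟨k, hk⟩ := hd'1
      have e : d' = 1 + 9 * k := by push_cast at hk; linear_combination hk
      rw [e]; exact isCoprime_one_right.add_mul_left_right k
    have hMx : IsCoprime (M' : ℤ) d' := by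
      obtain ⟨k, hk⟩ := hd'd
      have e : d' = d + M' * (3 * k) := by push_cast at hk; linear_combination hk
      rw [e]
      exact hdQM.of_mul_right_right.symm.add_mul_left_right (3 * k)
    rw [hNZ']
    exact h9x.mul_left hMx
  obtain ⟨γ', hγ'⟩ := exists_gamma0_apply_one_one_eq_of_isUnit hunitN
  have hγ'x : (N : ℤ) ∣ d' - ((γ' : SL(2, ℤ)) 1 1 : ℤ) := (ZMod.intCast_eq_intCast_iff_dvd_sub _ _ N).mp hγ'
  have hN9 : ((9 : ℕ) : ℤ) ∣ (N : ℤ) := by exact_mod_cast h9N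
  have hN3M : ((3 * M' : ℕ) : ℤ) ∣ (N : ℤ) := ⟨3, by rw [hN]; push_cast; ring⟩
  -- `{∞, γ'∞} ∈ Λ₁` by parity at `Q = 9`
  have hγ'9 : ((9 : ℕ) : ℤ) ∣ ((γ' : SL(2, ℤ)) 1 1 : ℤ) - 1 := by
    have e : ((γ' : SL(2, ℤ)) 1 1 : ℤ) - 1 = (d' - 1) - (d' - ((γ' : SL(2, ℤ)) 1 1 : ℤ)) := by ring
    rw [e]; exact dvd_sub hd'1 (hN9.trans hγ'x)
  have hmem' := cuspSymbol_mem_periodLatticeGamma1_of_atkinLehner_minus_of_nine_dvd D h9 9 h9N hc9 (by norm_num) hε γ' hγ'9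
  -- `{∞, γ∞} ≡ {∞, γ'∞}` by cuspidal inertia (`u = 3`, `v = M'`)
  have hmod : ((((γ : SL(2, ℤ)) 1 1 : ℤ)) : ZMod (3 * M')) = (((γ' : SL(2, ℤ)) 1 1 : ℤ) : ZMod (3 * M')) := by
    refine (ZMod.intCast_eq_intCast_iff_dvd_sub _ _ (3 * M')).mpr ?_
    have e : ((γ' : SL(2, ℤ)) 1 1 : ℤ) - d = (d' - d) - (d' - ((γ' : SL(2, ℤ)) 1 1 : ℤ)) := by ring
    rw [e]; exact dvd_sub hd'd (hN3M.trans hγ'x)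
  have hdiff := cuspSymbol_sub_mem_periodLatticeGamma1_of_apply_eq_mod D.f (u := 3) (v := M') (by norm_num) hNZ γ γ' hmod
  have e : cuspSymbol D.f γ = cuspSymbol D.f γ' - (cuspSymbol D.f γ' - cuspSymbol D.f γ) := by ring
  rw [e]
  exact sub_mem hmem' hdiff

/-! ## §4 The Atkin–Lehner sign pattern of a Shimura `3`-kernel (E-an-221's habitat) -/

/-- **A Shimura third-period forbids a minus divisor `Q ∥ N` with `3 ∤ φ(Q)`** (`9 ∣ N`, lattice-optimal): `w_Q f = −f ⟹ 3 ∣ φ(Q)`.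
[cite: AtkinLehner1970, Thm. 3] -/
theorem three_dvd_totient_of_kummerShimura_of_atkinLehner_minus (D : ModularParametrizationData W N)
    (hopt : ∀ z ∈ D.L.lattice, ∃ w ∈ periodLattice D.f, z = D.c * w) (h9 : 3 ^ 2 ∣ N)
    {u : ℂ} (hu₂ : 3 * u ∈ D.L.lattice) (hS : KummerShimura D u)
    (Q : ℕ) [NeZero Q] (hQN : Q ∣ N) (hc : Nat.Coprime Q (N / Q)) (hQ : 1 < Q)
    (hε : atkinLehnerInvolution N 2 Q D.f = (-1 : ℂ) • D.f) : 3 ∣ Nat.totient Q := by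
  by_contra h3
  exact not_kummerShimura_of_periodLatticeGamma1_eq D hopt
    (periodLatticeGamma1_eq_of_atkinLehner_minus_of_coprime_totient D h9 Q hQN hc hQ hε
      ((Nat.Prime.coprime_iff_not_dvd Nat.prime_three).mpr h3)) hu₂ hS

/-- **A Shimura third-period forbids TWO coprime minus divisors** (`9 ∣ N`, lattice-optimal). [cite: AtkinLehner1970, Thm. 3] -/
theorem not_two_atkinLehner_minus_of_kummerShimura (D : ModularParametrizationData W N)
    (hopt : ∀ z ∈ D.L.lattice, ∃ w ∈ periodLattice D.f, z = D.c * w) (h9 : 3 ^ 2 ∣ N)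
    {u : ℂ} (hu₂ : 3 * u ∈ D.L.lattice) (hS : KummerShimura D u)
    (Q₁ Q₂ : ℕ) [NeZero Q₁] [NeZero Q₂] (h₁ : Q₁ ∣ N) (hc₁ : Nat.Coprime Q₁ (N / Q₁)) (hQ₁ : 1 < Q₁)
    (h₂ : Q₂ ∣ N) (hc₂ : Nat.Coprime Q₂ (N / Q₂)) (hQ₂ : 1 < Q₂) (hcop : Nat.Coprime Q₁ Q₂)
    (hε₁ : atkinLehnerInvolution N 2 Q₁ D.f = (-1 : ℂ) • D.f) : atkinLehnerInvolution N 2 Q₂ D.f = (1 : ℂ) • D.f := by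
  rcases atkinLehner_eq_smul_or D Q₂ h₂ hc₂ with h | h
  · exact h
  · exact absurd hS (not_kummerShimura_of_periodLatticeGamma1_eq D hopt
      (periodLatticeGamma1_eq_of_two_atkinLehner_minus D h9 Q₁ Q₂ h₁ hc₁ hQ₁ h₂ hc₂ hQ₂ hcop hε₁ h) hu₂)

/-- **A Shimura third-period at `9 ∥ N` forces `w₉ f = +f`** (`N = 9M'`, `3 ∤ M'`, lattice-optimal). [cite: AtkinLehner1970, Thm. 3] -/
theorem atkinLehner_nine_plus_of_kummerShimura (D : ModularParametrizationData W N)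
    (hopt : ∀ z ∈ D.L.lattice, ∃ w ∈ periodLattice D.f, z = D.c * w) {M' : ℕ} (hN : N = 9 * M') (hM' : Nat.Coprime 3 M')
    {u : ℂ} (hu₂ : 3 * u ∈ D.L.lattice) (hS : KummerShimura D u) : atkinLehnerInvolution N 2 9 D.f = (1 : ℂ) • D.f := by
  have h9N : 9 ∣ N := ⟨M', hN⟩
  have hc9 : Nat.Coprime 9 (N / 9) := by
    have hNQ : N / 9 = M' := by rw [hN]; exact Nat.mul_div_cancel_left M' (by norm_num)
    rw [hNQ]; exact (Nat.Coprime.pow_left 2 hM' : Nat.Coprime (3 ^ 2) M')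
  rcases atkinLehner_eq_smul_or D 9 h9N hc9 with h | h
  · exact h
  · exact absurd hS (not_kummerShimura_of_periodLatticeGamma1_eq D hopt (periodLatticeGamma1_eq_of_atkinLehner_nine_minus D hN hM' h) hu₂)

/-- **E-an-221 HOLDS OUTRIGHT when two coprime exact divisors are both Atkin–Lehner minus** (vacuously). [cite: AtkinLehner1970, Thm. 3] -/
theorem shimuraThreeKernelForcesRationalThreeTorsionAtNine_of_two_atkinLehner_minus
    (W : WeierstrassCurve ℚ) [W.IsElliptic] [W.IsGloballyMinimal] {N : ℕ} [NeZero N]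
    (D : ModularParametrizationData W N)
    (hopt : ∀ z ∈ D.L.lattice, ∃ w ∈ periodLattice D.f, z = D.c * w) (h9 : 3 ^ 2 ∣ N)
    (Q₁ Q₂ : ℕ) [NeZero Q₁] [NeZero Q₂] (h₁ : Q₁ ∣ N) (hc₁ : Nat.Coprime Q₁ (N / Q₁)) (hQ₁ : 1 < Q₁)
    (h₂ : Q₂ ∣ N) (hc₂ : Nat.Coprime Q₂ (N / Q₂)) (hQ₂ : 1 < Q₂) (hcop : Nat.Coprime Q₁ Q₂)
    (hε₁ : atkinLehnerInvolution N 2 Q₁ D.f = (-1 : ℂ) • D.f) (hε₂ : atkinLehnerInvolution N 2 Q₂ D.f = (-1 : ℂ) • D.f)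
    (u : ℂ) (hu₂ : 3 * u ∈ D.L.lattice) (hS : KummerShimura D u) : ∃ X Y : ℚ, IsShortThreeTorsion W D.c X Y :=
  absurd hS (not_kummerShimura_of_periodLatticeGamma1_eq D hopt
    (periodLatticeGamma1_eq_of_two_atkinLehner_minus D h9 Q₁ Q₂ h₁ hc₁ hQ₁ h₂ hc₂ hQ₂ hcop hε₁ hε₂) hu₂)

end Summit.BirchSwinnertonDyer.BirchSwinnertonDyer.Theorems.ManinLocalTwoThree.SigmaHabitat

end
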